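import Summits.CriticalPhenomena.PercolationContinuityZ3.Theorems.PercNearOneGluingNoHeavyLowerTailIncStarRatioCollapse
import Summits.CriticalPhenomena.PercolationContinuityZ3.Theorems.PercNearOneGluingAdditiveGluingOneBond
import HarnessLib

/-!
# R23 — hence the increasing star — from BERNSTEIN-CHORD positivity of the R23 margin along every other pair

Support file for the Sahi programme (`--supports stmt-CriticalPhenomena-4575`, prover prim-sahi-p2 gen 31).  No definitions, no named facts, no
sorries; standard axioms.  Memo `run/shared/lean/prim/prim-sahi/FROM-prim-sahi-p2-gen31-R23-ROOT-FIBRES.md`, `prim-sahi-p2/PROOF-E3.md` §41.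

Gen 30 reduced the increasing star `E₃({s↔b},{s↔c},{s↔y}) ≥ 0` to ONE inequality along root–unmarked pairs `e = s(s,z)`: R23, `2·E₃(P¹) ≤ 3·polar₁(P¹,P⁰)`
with `P¹ = P_{w[e↦1]}`, `P⁰ = P_{w[e↦0]}` (`IncStar.incStar_nonneg_of_ratio23'`).  Write `𝓡(w) = 3·polar₁(P¹,P⁰) − 2·E₃(P¹)` for the R23 MARGIN of the weight `w`
(events and `e` fixed).  Along any other pair `g ≠ e` of weight `λ = w g` the margin is a Bernstein cubic `𝓡(w) = Σ_k B_k(λ)Ψ_k` whose end coefficients are the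
margins of `w[g↦0]` and `w[g↦1]` (one-bond decomposition of both laws); gen 31's exact census (≈ 19 600 instances: random, dense and W145-support graphs, every
edge type) found the two MIXED coefficients `Ψ₁, Ψ₂` nonnegative without exception (memo §0–§1; CONJECTURE EB(𝓡)), and at a degree-two root they are CERTIFIED
(memo §3: width-1 root fibres, `RF₁ ∈ cone(Harris⊗states)`, `RF₂ − ⅔RF₃ ∈ cone(Harris)`).  `Ψ₁, Ψ₂ ≥ 0` is equivalent to the BERNSTEIN-CHORD inequality
`𝓡(w) ≥ (1−λ)³·𝓡(w[g↦0]) + λ³·𝓡(w[g↦1])` for all weights (the mixed part `3λ(1−λ)[(1−λ)Ψ₁ + λΨ₂]` is nonnegative).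

* `openConn_sdiff_diag`, `real_update_diag_zero` — loops are invisible: removing a diagonal pair from a configuration does not change any open connection, so
  setting the weight of a loop to `0` does not change the probability of (intersections of) connection events;
* `polar₁_nonneg_of_zeroOne` — base case: if every weight of `w¹ ≥ w⁰` is `0` or `1` then `polar₁(P_{w¹}, P_{w⁰}; A,B,C) ≥ 0` for increasing `A, B, C`
  (for point masses at `ω¹ ⊇ ω⁰`, `3·polar₁ = 2q_Aq_Bq_C + p_Ap_Bp_C − Σ_cyc p_A q_B q_C = Π(p−q) + Σ_cyc q_A(p_B−q_B)(p_C−q_C) ≥ 0` with `p ≥ q` the indicators);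
* **`r23_of_bernsteinChord`** — if the Bernstein-chord inequality holds along every non-diagonal fractional pair `g ≠ e` of every weight, then R23 holds for every
  weight, every pair `e` and all `s b c y` (induction on the number of fractional pairs other than `e`; loops are removed by `real_update_diag_zero`);
* **`incStar_nonneg_of_bernsteinChord`** — hence the increasing star on every finite weighted graph (`incStar_nonneg_of_ratio23'`).

Nothing here asserts the Bernstein-chord inequality; it is the census-clean conjecture EB(𝓡) of the memo, proved so far at degree-two roots only.
-/

noncomputable section

namespace Summit.CriticalPhenomena.PercolationContinuityZ3.Theorems

namespace IncStar

open MeasureTheory Set Literature.Probability.Percolation Literature.Probability.LatticeModels EdgeInduction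
open scoped Classical

variable {n : ℕ}

/-! ### Loops are invisible -/

/-- Removing a diagonal pair (a loop) from a configuration does not change the open graph. [folklore] -/
theorem openGraph_sdiff_diag {g : Sym2 (Fin n)} (hg : g.IsDiag) (ω : BondConfig (Fin n)) :
    openGraph (ω \ {g}) = openGraph ω := by
  ext v u
  simp only [openGraph_adj, mem_sdiff, mem_singleton_iff]
  constructor
  · rintro ⟨⟨h1, -⟩, h2⟩
    exact ⟨h1, h2⟩
  · rintro ⟨h1, h2⟩
    refine ⟨⟨h1, ?_⟩, h2⟩
    rintro rfl
    exact h2 (Sym2.mk_isDiag_iff.1 hg)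

/-- Removing a loop does not change an open connection. [folklore] -/
theorem openConn_sdiff_diag {g : Sym2 (Fin n)} (hg : g.IsDiag) (x t : Fin n) :
    (fun ω : BondConfig (Fin n) => ω \ {g}) ⁻¹' (openConn x t) = openConn x t := by
  ext ω
  simp only [mem_preimage, openConn, mem_setOf_eq, openGraph_sdiff_diag hg]

/-- Setting the weight of a loop to `0` does not change the probability of an event invariant under removing the loop. [folklore] -/
theorem real_update_diag_zero (v : Sym2 (Fin n) → unitInterval) {g : Sym2 (Fin n)}
    (S : Set (BondConfig (Fin n))) (hS : (fun ω : BondConfig (Fin n) => ω \ {g}) ⁻¹' S = S) :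
    (prodBernoulli (Function.update v g 0)).real S = (prodBernoulli v).real S := by
  have hmeas : Measurable fun ω : BondConfig (Fin n) => ω \ {g} :=
    Literature.Probability.Percolation.StarTriangle.measurable_sdiff_const _
  rw [← Literature.Probability.Percolation.StarTriangle.prodBernoulli_map_sdiff_singleton,
    map_measureReal_apply hmeas (Set.toFinite _).measurableSet, hS]

/-- The seven events of the increasing star are invariant under removing a loop. [folklore] -/
theorem star_events_sdiff_diag {g : Sym2 (Fin n)} (hg : g.IsDiag) (s b c y : Fin n) :
    let f := fun ω : BondConfig (Fin n) => ω \ {g}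
    let A : Set (BondConfig (Fin n)) := openConn s b
    let B : Set (BondConfig (Fin n)) := openConn s c
    let C : Set (BondConfig (Fin n)) := openConn s y
    f ⁻¹' (A ∩ B ∩ C) = A ∩ B ∩ C ∧ f ⁻¹' A = A ∧ f ⁻¹' B = B ∧ f ⁻¹' C = C ∧
      f ⁻¹' (B ∩ C) = B ∩ C ∧ f ⁻¹' (A ∩ C) = A ∩ C ∧ f ⁻¹' (A ∩ B) = A ∩ B := by
  refine ⟨?_, ?_, ?_, ?_, ?_, ?_, ?_⟩ <;> simp only [Set.preimage_inter, openConn_sdiff_diag hg]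

/-- The R23 margin does not see loops: for a diagonal `g ≠ e`, setting `w g := 0` changes neither `E₃(P_{w[e↦1]})` nor `polar₁(P_{w[e↦1]}, P_{w[e↦0]})`
of the star events. [this work] -/
theorem r23Margin_update_diag_zero (v : Sym2 (Fin n) → unitInterval) {e g : Sym2 (Fin n)} (hge : g ≠ e) (hg : g.IsDiag) (s b c y : Fin n) :
    3 * polar₁ (prodBernoulli (Function.update (Function.update v g 0) e 1)) (prodBernoulli (Function.update (Function.update v g 0) e 0))
        (openConn s b) (openConn s c) (openConn s y)
      - 2 * sahiE3 (prodBernoulli (Function.update (Function.update v g 0) e 1)) (openConn s b) (openConn s c) (openConn s y) =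
    3 * polar₁ (prodBernoulli (Function.update v e 1)) (prodBernoulli (Function.update v e 0)) (openConn s b) (openConn s c) (openConn s y)
      - 2 * sahiE3 (prodBernoulli (Function.update v e 1)) (openConn s b) (openConn s c) (openConn s y) := by
  obtain ⟨h7, hA, hB, hC, hBC, hAC, hAB⟩ := star_events_sdiff_diag (n := n) hg s b c y
  rw [Function.update_comm hge (0 : unitInterval) (1 : unitInterval) v, Function.update_comm hge (0 : unitInterval) (0 : unitInterval) v]
  simp only [polar₁, sahiE3, real_update_diag_zero _ _ h7, real_update_diag_zero _ _ hA, real_update_diag_zero _ _ hB,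
    real_update_diag_zero _ _ hC, real_update_diag_zero _ _ hBC, real_update_diag_zero _ _ hAC, real_update_diag_zero _ _ hAB]

/-! ### Base case: deterministic weights -/

/-- For reals `0 ≤ q_i ≤ p_i` (i = 1,2,3): `Σ_cyc p_A q_B q_C ≤ 2 q_Aq_Bq_C + p_Ap_Bp_C`, because the difference is
`Π(p_i − q_i) + Σ_cyc q_A (p_B − q_B)(p_C − q_C)`. [folklore] -/
theorem dirac_polar_poly_nonneg {pA pB pC qA qB qC : ℝ} (hA : qA ≤ pA) (hB : qB ≤ pB) (hC : qC ≤ pC)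
    (hA0 : 0 ≤ qA) (hB0 : 0 ≤ qB) (hC0 : 0 ≤ qC) :
    pA * qB * qC + pB * qA * qC + pC * qA * qB ≤ 2 * (qA * qB * qC) + pA * pB * pC := by
  have key : 2 * (qA * qB * qC) + pA * pB * pC - (pA * qB * qC + pB * qA * qC + pC * qA * qB)
      = (pA - qA) * (pB - qB) * (pC - qC) + (qA * ((pB - qB) * (pC - qC)) + qB * ((pA - qA) * (pC - qC)) + qC * ((pA - qA) * (pB - qB))) := by
    ring
  have h1 : 0 ≤ (pA - qA) * (pB - qB) * (pC - qC) :=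
    mul_nonneg (mul_nonneg (sub_nonneg.2 hA) (sub_nonneg.2 hB)) (sub_nonneg.2 hC)
  have h2 : 0 ≤ qA * ((pB - qB) * (pC - qC)) := mul_nonneg hA0 (mul_nonneg (sub_nonneg.2 hB) (sub_nonneg.2 hC))
  have h3 : 0 ≤ qB * ((pA - qA) * (pC - qC)) := mul_nonneg hB0 (mul_nonneg (sub_nonneg.2 hA) (sub_nonneg.2 hC))
  have h4 : 0 ≤ qC * ((pA - qA) * (pB - qB)) := mul_nonneg hC0 (mul_nonneg (sub_nonneg.2 hA) (sub_nonneg.2 hB))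
  linarith

/-- **Base case.**  If the weights `w¹, w⁰` take only the values `0, 1` and `w⁰ ≤ w¹` pointwise, then for increasing events `A, B, C` the polarised
Bernstein coefficient `polar₁(P_{w¹}, P_{w⁰}; A, B, C)` is nonnegative (both laws are point masses, at configurations `ω¹ ⊇ ω⁰`). [this work] -/
theorem polar₁_nonneg_of_zeroOne (w1 w0 : Sym2 (Fin n) → unitInterval) (h1 : ∀ f, w1 f = 0 ∨ w1 f = 1) (h0 : ∀ f, w0 f = 0 ∨ w0 f = 1)
    (hle : ∀ f, w0 f = 1 → w1 f = 1) {A B C : Set (BondConfig (Fin n))} (hA : IsUpperSet A) (hB : IsUpperSet B) (hC : IsUpperSet C) :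
    0 ≤ polar₁ (prodBernoulli w1) (prodBernoulli w0) A B C := by
  have hsub : ({f | w0 f = 1} : BondConfig (Fin n)) ≤ {f | w1 f = 1} := fun f hf => hle f hf
  -- indicators
  have ind : ∀ (S : Set (BondConfig (Fin n))) (U : BondConfig (Fin n)), (if U ∈ S then (1 : ℝ) else 0) = S.indicator 1 U := by
    intro S U; simp only [Set.indicator_apply, Pi.one_apply]
  have indI : ∀ (S T : Set (BondConfig (Fin n))) (U : BondConfig (Fin n)),
      (S ∩ T).indicator (1 : BondConfig (Fin n) → ℝ) U = S.indicator 1 U * T.indicator 1 U := by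
    intro S T U; rw [Set.inter_indicator_one]; rfl
  simp only [polar₁, real_eq_ite_of_zeroOne w1 h1, real_eq_ite_of_zeroOne w0 h0, ind, indI]
  set U1 : BondConfig (Fin n) := {f | w1 f = 1}
  set U0 : BondConfig (Fin n) := {f | w0 f = 1}
  have i01 : ∀ S : Set (BondConfig (Fin n)), 0 ≤ S.indicator (1 : BondConfig (Fin n) → ℝ) U0 ∧ S.indicator (1 : BondConfig (Fin n) → ℝ) U0 ≤ 1 :=
    fun S => ⟨Set.indicator_nonneg (fun _ _ => zero_le_one) _, Set.indicator_le_self' (fun _ _ => zero_le_one) _⟩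
  have i11 : ∀ S : Set (BondConfig (Fin n)), 0 ≤ S.indicator (1 : BondConfig (Fin n) → ℝ) U1 ∧ S.indicator (1 : BondConfig (Fin n) → ℝ) U1 ≤ 1 :=
    fun S => ⟨Set.indicator_nonneg (fun _ _ => zero_le_one) _, Set.indicator_le_self' (fun _ _ => zero_le_one) _⟩
  have mono : ∀ S : Set (BondConfig (Fin n)), IsUpperSet S →
      S.indicator (1 : BondConfig (Fin n) → ℝ) U0 ≤ S.indicator (1 : BondConfig (Fin n) → ℝ) U1 := by
    intro S hS
    by_cases h : U0 ∈ S
    · have h' : U1 ∈ S := hS hsub h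
      simp [Set.indicator_of_mem h, Set.indicator_of_mem h']
    · simp only [Set.indicator_of_notMem h]
      exact (i11 S).1
  -- for 0/1 indicators x: x = x*x, used to rewrite the 'idempotent' structure is not needed: the target is multilinear.  Reduce to `dirac_polar_poly_nonneg`
  -- plus the two remaining groups, which are themselves nonnegative.
  set a1 := A.indicator (1 : BondConfig (Fin n) → ℝ) U1
  set b1 := B.indicator (1 : BondConfig (Fin n) → ℝ) U1
  set c1 := C.indicator (1 : BondConfig (Fin n) → ℝ) U1
  set a0 := A.indicator (1 : BondConfig (Fin n) → ℝ) U0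
  set b0 := B.indicator (1 : BondConfig (Fin n) → ℝ) U0
  set c0 := C.indicator (1 : BondConfig (Fin n) → ℝ) U0
  -- indicators are idempotent
  have idem : ∀ (S : Set (BondConfig (Fin n))) (U : BondConfig (Fin n)),
      S.indicator (1 : BondConfig (Fin n) → ℝ) U * S.indicator (1 : BondConfig (Fin n) → ℝ) U = S.indicator 1 U := by
    intro S U; by_cases h : U ∈ S
    · simp [Set.indicator_of_mem h]
    · simp [Set.indicator_of_notMem h]
  have ha := dirac_polar_poly_nonneg (mono A hA) (mono B hB) (mono C hC) (i01 A).1 (i01 B).1 (i01 C).1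
  -- 3·polar₁ = 2 a0b0c0 + 4 a1b1c1 + (a0 b1 c1 + a1 b0 c1 + a1 b1 c0) − Σ_cyc a1 (b1 c1) − Σ_cyc (a0 (b1 c1) + a1 (b0 c0))
  --          = [2 a0b0c0 + a1b1c1 − Σ_cyc a1 b0 c0]  ≥ 0
  nlinarith [ha, idem A U1, idem B U1, idem C U1, (i11 A).1, (i11 B).1, (i11 C).1]

/-- The R23 margin is nonnegative when every pair other than `e` carries weight `0` or `1`. [this work] -/
theorem r23Margin_nonneg_of_zeroOne (v : Sym2 (Fin n) → unitInterval) (e : Sym2 (Fin n)) (hv : ∀ f, f ≠ e → v f = 0 ∨ v f = 1)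
    (s b c y : Fin n) :
    2 * sahiE3 (prodBernoulli (Function.update v e 1)) (openConn s b) (openConn s c) (openConn s y) ≤
      3 * polar₁ (prodBernoulli (Function.update v e 1)) (prodBernoulli (Function.update v e 0)) (openConn s b) (openConn s c) (openConn s y) := by
  have h1 : ∀ f, Function.update v e 1 f = 0 ∨ Function.update v e 1 f = 1 := by
    intro f
    by_cases hf : f = e
    · subst hf; simp
    · rw [Function.update_of_ne hf]; exact hv f hf
  have h0 : ∀ f, Function.update v e 0 f = 0 ∨ Function.update v e 0 f = 1 := by
    intro f
    by_cases hf : f = e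
    · subst hf; simp
    · rw [Function.update_of_ne hf]; exact hv f hf
  have hle : ∀ f, Function.update v e 0 f = 1 → Function.update v e 1 f = 1 := by
    intro f hf
    by_cases hfe : f = e
    · subst hfe; simp
    · rw [Function.update_of_ne hfe] at hf ⊢; exact hf
  rw [sahiE3_eq_zero_of_zeroOne _ h1]
  have := polar₁_nonneg_of_zeroOne _ _ h1 h0 hle (isUpperSet_openConn s b) (isUpperSet_openConn s c) (isUpperSet_openConn s y)
  linarith

/-! ### The induction -/

/-- **R23 FROM THE BERNSTEIN-CHORD INEQUALITY.**  Suppose that for every weight `v`, every pair `e`, all `s b c y` and every NON-DIAGONAL fractional pair `g ≠ e`,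
the R23 margin `𝓡(v) = 3·polar₁(P_{v[e↦1]}, P_{v[e↦0]}) − 2·E₃(P_{v[e↦1]})` of the star events satisfies the Bernstein-chord inequality
`(1 − v g)³·𝓡(v[g↦0]) + (v g)³·𝓡(v[g↦1]) ≤ 𝓡(v)` (equivalently: the two mixed Bernstein coefficients of `𝓡` along `g` are nonnegative — CONJECTURE EB(𝓡) of the memo,
census-clean, certified at degree-two roots).  Then R23 holds along every pair of every finite weighted graph: `2·E₃(P_{w[e↦1]}) ≤ 3·polar₁(P_{w[e↦1]}, P_{w[e↦0]})`.
(Induction on the number of fractional pairs other than `e`: a fractional loop is switched off by `r23Margin_update_diag_zero`, a fractional non-loop is removed by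
the hypothesis — both end weights have fewer fractional pairs — and the base case is `r23Margin_nonneg_of_zeroOne`.) [this work] -/
theorem r23_of_bernsteinChord
    (hB : ∀ (v : Sym2 (Fin n) → unitInterval) (e g : Sym2 (Fin n)) (s b c y : Fin n), g ≠ e → ¬ g.IsDiag → g ∈ fracEdges v →
      (1 - (v g : ℝ)) ^ 3 *
          (3 * polar₁ (prodBernoulli (Function.update (Function.update v g 0) e 1)) (prodBernoulli (Function.update (Function.update v g 0) e 0))
                (openConn s b) (openConn s c) (openConn s y)
            - 2 * sahiE3 (prodBernoulli (Function.update (Function.update v g 0) e 1)) (openConn s b) (openConn s c) (openConn s y))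
        + (v g : ℝ) ^ 3 *
          (3 * polar₁ (prodBernoulli (Function.update (Function.update v g 1) e 1)) (prodBernoulli (Function.update (Function.update v g 1) e 0))
                (openConn s b) (openConn s c) (openConn s y)
            - 2 * sahiE3 (prodBernoulli (Function.update (Function.update v g 1) e 1)) (openConn s b) (openConn s c) (openConn s y))
      ≤ 3 * polar₁ (prodBernoulli (Function.update v e 1)) (prodBernoulli (Function.update v e 0)) (openConn s b) (openConn s c) (openConn s y)
          - 2 * sahiE3 (prodBernoulli (Function.update v e 1)) (openConn s b) (openConn s c) (openConn s y))
    (w : Sym2 (Fin n) → unitInterval) (e : Sym2 (Fin n)) (s b c y : Fin n) :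
    2 * sahiE3 (prodBernoulli (Function.update w e 1)) (openConn s b) (openConn s c) (openConn s y) ≤
      3 * polar₁ (prodBernoulli (Function.update w e 1)) (prodBernoulli (Function.update w e 0)) (openConn s b) (openConn s c) (openConn s y) := by
  -- induction on the number of fractional pairs other than `e`
  suffices H : ∀ (k : ℕ) (v : Sym2 (Fin n) → unitInterval), ((fracEdges v).erase e).card ≤ k →
      2 * sahiE3 (prodBernoulli (Function.update v e 1)) (openConn s b) (openConn s c) (openConn s y) ≤
        3 * polar₁ (prodBernoulli (Function.update v e 1)) (prodBernoulli (Function.update v e 0)) (openConn s b) (openConn s c) (openConn s y) from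
    H _ w le_rfl
  intro k
  induction k with
  | zero =>
      intro v hk
      refine r23Margin_nonneg_of_zeroOne v e (fun f hf => eq_zero_or_one_of_not_mem_fracEdges ?_) s b c y
      intro hmem
      have : f ∈ (fracEdges v).erase e := Finset.mem_erase.2 ⟨hf, hmem⟩
      have : 0 < ((fracEdges v).erase e).card := Finset.card_pos.2 ⟨f, this⟩
      omega
  | succ k ih =>
      intro v hk
      by_cases hex : ((fracEdges v).erase e).Nonempty
      · obtain ⟨g, hg⟩ := hex
        obtain ⟨hge, hgf⟩ := Finset.mem_erase.1 hg
        -- both end weights have fewer fractional pairs other than `e`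
        have hcard : ∀ (u : unitInterval), u = 0 ∨ u = 1 → ((fracEdges (Function.update v g u)).erase e).card ≤ k := by
          intro u hu
          have hsub : (fracEdges (Function.update v g u)).erase e ⊆ ((fracEdges v).erase e).erase g := by
            intro f hf
            obtain ⟨hfe, hff⟩ := Finset.mem_erase.1 hf
            have hf' := fracEdges_update_subset v g u hu hff
            obtain ⟨hfg, hfv⟩ := Finset.mem_erase.1 hf'
            exact Finset.mem_erase.2 ⟨hfg, Finset.mem_erase.2 ⟨hfe, hfv⟩⟩
          have h1 := Finset.card_le_card hsub
          rw [Finset.card_erase_of_mem hg] at h1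
          omega
        by_cases hdiag : g.IsDiag
        · -- a loop: switch it off, nothing changes
          have hq := r23Margin_update_diag_zero v hge hdiag s b c y
          have i0 := ih (Function.update v g 0) (hcard 0 (Or.inl rfl))
          linarith
        · have step := hB v e g s b c y hge hdiag hgf
          have i0 := ih (Function.update v g 0) (hcard 0 (Or.inl rfl))
          have i1 := ih (Function.update v g 1) (hcard 1 (Or.inr rfl))
          have hp0 : (0 : ℝ) ≤ v g := (v g).2.1
          have hp1 : (v g : ℝ) ≤ 1 := (v g).2.2
          have hq0 : (0 : ℝ) ≤ (1 - (v g : ℝ)) ^ 3 := pow_nonneg (by linarith) 3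
          have hq1 : (0 : ℝ) ≤ (v g : ℝ) ^ 3 := pow_nonneg hp0 3
          nlinarith [mul_nonneg hq0 (sub_nonneg.2 i0), mul_nonneg hq1 (sub_nonneg.2 i1)]
      · rw [Finset.not_nonempty_iff_eq_empty] at hex
        refine r23Margin_nonneg_of_zeroOne v e (fun f hf => eq_zero_or_one_of_not_mem_fracEdges ?_) s b c y
        intro hmem
        have : f ∈ (fracEdges v).erase e := Finset.mem_erase.2 ⟨hf, hmem⟩
        rw [hex] at this
        simp at this

/-- **THE INCREASING STAR FROM THE BERNSTEIN-CHORD INEQUALITY FOR THE R23 MARGIN.**  Under the hypothesis of `r23_of_bernsteinChord`, Sahi's cubic of the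
increasing star is nonnegative on every finite weighted graph: `E₃({s↔b},{s↔c},{s↔y}) ≥ 0` under `prodBernoulli w` for every weight `w` on the pairs of `Fin n`
and all `s b c y` (`r23_of_bernsteinChord` + `incStar_nonneg_of_ratio23'`). [this work] -/
theorem incStar_nonneg_of_bernsteinChord
    (hB : ∀ (v : Sym2 (Fin n) → unitInterval) (e g : Sym2 (Fin n)) (s b c y : Fin n), g ≠ e → ¬ g.IsDiag → g ∈ fracEdges v →
      (1 - (v g : ℝ)) ^ 3 *
          (3 * polar₁ (prodBernoulli (Function.update (Function.update v g 0) e 1)) (prodBernoulli (Function.update (Function.update v g 0) e 0))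
                (openConn s b) (openConn s c) (openConn s y)
            - 2 * sahiE3 (prodBernoulli (Function.update (Function.update v g 0) e 1)) (openConn s b) (openConn s c) (openConn s y))
        + (v g : ℝ) ^ 3 *
          (3 * polar₁ (prodBernoulli (Function.update (Function.update v g 1) e 1)) (prodBernoulli (Function.update (Function.update v g 1) e 0))
                (openConn s b) (openConn s c) (openConn s y)
            - 2 * sahiE3 (prodBernoulli (Function.update (Function.update v g 1) e 1)) (openConn s b) (openConn s c) (openConn s y))
      ≤ 3 * polar₁ (prodBernoulli (Function.update v e 1)) (prodBernoulli (Function.update v e 0)) (openConn s b) (openConn s c) (openConn s y)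
          - 2 * sahiE3 (prodBernoulli (Function.update v e 1)) (openConn s b) (openConn s c) (openConn s y)) :
    ∀ (w : Sym2 (Fin n) → unitInterval) (s b c y : Fin n),
      0 ≤ sahiE3 (prodBernoulli w) (openConn s b) (openConn s c) (openConn s y) :=
  incStar_nonneg_of_ratio23' fun w s b c y z _ _ _ _ _ => r23_of_bernsteinChord hB w s(s, z) s b c y

end IncStar

end Summit.CriticalPhenomena.PercolationContinuityZ3.Theorems

end
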